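import Summits.QuantumFields.YangMills.Theorems.DiagonalMirrorRPRDiagonalSliceModelRestrict
import Summits.QuantumFields.YangMills.Theorems.DiagonalMirrorRPRFamObsGrowth
import Summits.QuantumFields.YangMills.Theorems.MirrorModularBoostsHypercubicLimitCouplingResponseDefsC

/-!
# Crux `WeakCouplingHypercubicLimitRP` (stmt-QuantumFields-27398), line `Sketch`, door B (`sign-twisted-diagonal-trace`):
# the door-B LETTERS `OddTwistGap` / `DiagLukewarm` / `TemperateRenormalisation` / `SideGrowth` / `Growth` / `TwistLetters` /
# `PolyRenormCounterterm` / `PolyCounterterm` and their adapters, re-homed under `Theorems/` (κ3 text), and the letters ALONG a subsequence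

Helper file (`--supports stmt-QuantumFields-27398 --as helper`) of the hand `hand-10604-wilsonDiagModel-2` (docket director-ym g23,
O4 WORD 18 (3)(ii) / 19 / 20: door-B suppliers along `φ`) for the registered stub D1 `stub_diagRPOfPlaneLimits` of
`Cruxes/WeakCouplingHypercubicLimitRP/Lines/Sketch.lean` (sha16 `7bf38c709623ad77`); it closes nothing by itself.

WHAT.  §3 + §3b of the door-B core workfile `Cruxes/DiagonalMirrorRPR/Lines/sign_twisted_diagonal_trace_core.lean` in the κ3 TEXT OF RECORD
(critic idea-crit-9 g12 bytes `900935a36c50070a`, GIVEN by director-ym O4 WORD 19 (1): `TemperateRenormalisation` re-typed to the RENORMALISED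
counterterm `|c_k| ≤ a_k⁻¹^p ∧ |c_k|·|m_k| ≤ a_k⁻¹^p` after the lead's located witness μ1; `PolyRenormCounterterm` added; `PolyCounterterm` and
`growth_of_poly` kept) — the eight definitions and six adapter theorems with signatures and bodies BYTE-FOR-BYTE and in the SAME namespace
`…Cruxes.DiagonalMirrorRPR.SignTwistedDiagonalTrace` (docstrings: the core's, plus one-liners on the four adapters that had none), exactly the
mechanism of κ1 (`…DiagonalSliceModelDefs`, p825205) and κ2′ (`…OddTorusSwapPairingDefs`, p827497): the line writer re-points the core by `import` +
deleting §3/§3b, and every later use (`famObs_supGrowth`, `tendsto_penalty_zero`, `core_of`, `diagonalFrameRP_of_twistLetters`) resolves to the same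
FQNs.  WHY: a `Theorems/` proof of the door-B composition «D1 ⟸ `TwistLetters` ∧ D1's binders» (the successor lead's docket, O4 WORD 20 (4)) must
NAME the letters; the companion `…DiagonalMirrorRPRDiagonalSliceModelRestrict` (p827367) could only state them unfolded.  NEW here (§3c): the
letters BY NAME along a strictly increasing `φ` — `OddTwistGap.restrict`, `DiagLukewarm.restrict` (model letters, via `DiagonalSliceModel.restrict`),
`TwistLetters.subseq`, `TemperateRenormalisation.subseq`, `PolyRenormCounterterm.subseq`, `PolyCounterterm.subseq`, `SideGrowth.subseq`,
`Growth.subseq` (one-liners over p827367's unfolded forms: every clause is a relation at the SAME index or a `Tendsto`/eventual statement — λ1),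
and `Growth` on every sub-scheme from D1's OWN binders `PolyRenorm ∧ UniformFunctionalBoundPlanes ∧ PolyVolume`
(`growth_subseq_of_polyRenorm_of_ufbPlanes`, through the landed κ3 adapter `polyRenormCounterterm_of_ufbPlanes`, p827519).

HONEST FRAMING: vocabulary and bookkeeping only.  No model letter is proved for Wilson's model; `wilsonDiagonalModel` is not landed; D1, the crux
⟨27398⟩ and its heart S6i are OPEN; nothing here bears on the summit; the Yang–Mills mass gap is NOT proved here or anywhere in the tree.  The
`Prop` definitions are PREDICATES on `(r, sch)` / on a model binder `𝔪` (the line's letters, NOT cited facts, NOT registered obligations).  No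
instance, no notation, `autoImplicit false`.

References: Osterwalder–Seiler, Ann. Phys. 110 (1978) §2–3; Seiler, LNP 159 (1982) Ch. 2; Kanazawa arXiv:0808.3442 Lemma 2; Tomboulis–Yaffe,
Comm. Math. Phys. 100 (1985) §2 (sign / multiplet structure of twisted transfer matrices).
-/

set_option autoImplicit false

noncomputable section

open scoped SchwartzMap
open MeasureTheory Filter Topology
open Literature.MathematicalPhysics.QuantumLattice Literature.MathematicalPhysics.AQFT
  Literature.MathematicalPhysics.QuantumFieldTheory Literature.Probability.LatticeModels
open Summit.QuantumFields.YangMills.Cruxes.HypercubicLimit.CouplingResponse (subseq UniformFunctionalBoundPlanes polyVolume_subseq)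

namespace Summit.QuantumFields.YangMills.Cruxes.DiagonalMirrorRPR.SignTwistedDiagonalTrace

/-! ## §3 The door-B letters (R1, R2) on an explicit model, and the scheme growth clause -/

section Letters

variable {G : Type} [Group G] [TopologicalSpace G] [IsTopologicalGroup G] [CompactSpace G]
  [MeasurableSpace G] [BorelSpace G] {r : LatticeRep G} {sch : SpeciesScheme (YMSpecies G)}

/-- **R1 `OddTwistGap`** (sign twist costs a physical-scale gap): the `U`-odd sector of the odd root `A_k`
(`U = sgn A_k`; NOT a momentum sector) lies spectrally below `exp(−γ a_k) · λ₀(k)` for some `γ > 0`, eventually. -/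
def OddTwistGap (𝔪 : DiagonalSliceModel r sch) : Prop :=
  ∃ γ : ℝ, 0 < γ ∧ ∀ᶠ k in atTop, ∀ j, 𝔪.sm k j ≤ Real.exp (-(γ * sch.a k)) * 𝔪.top k

/-- **R2 `DiagLukewarm`** (growth clause B2): for some `0 < θ < 1/2` and `C`, eventually
`Tr (|A_k|/λ₀(k))^{2t} ≤ C` for every `t ≥ θ · side_k` (temporal extent a fixed fraction of the torus:
temperature → 0 with the volume, no UV or entropy catastrophe). -/
def DiagLukewarm (𝔪 : DiagonalSliceModel r sch) : Prop :=
  ∃ θ : ℝ, 0 < θ ∧ θ < 1 / 2 ∧ ∃ C : ℝ, ∀ᶠ k in atTop, ∀ t : ℕ, θ * (sch.side k : ℝ) ≤ (t : ℝ) →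
    ∑' j, (𝔪.sp k j / 𝔪.top k) ^ (2 * t) + ∑' j, (𝔪.sm k j / 𝔪.top k) ^ (2 * t) ≤ C

variable (r sch)

/-- Scheme clause (i): the curvature channel's multiplicative renormalisation `c_k` and its RENORMALISED counterterm
`c_k · m_k` grow at most polynomially in the cutoff `a_k⁻¹`.  (Re-typed 2026-08-31, κ3, on lead-27398-D1's located witness
`c_k = e^{-1/a_k²}`, `m_k = e^{1/a_k}`: a bare bound on `|m_k|` is NOT implied by the D1 binders `PolyRenorm ∧ UFB ∧ PlaneLimits`,
while only the product `c_k m_k` enters `famObs = Σ c_i ∏ c_k (F − m_k)`; the product form IS implied by `PolyRenorm` and a uniform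
one-point functional bound.  `famObs_supGrowth` below uses exactly this form.) -/
def TemperateRenormalisation : Prop :=
  ∃ p : ℕ, ∀ᶠ k in atTop, |sch.c r.curvature k| ≤ (sch.a k)⁻¹ ^ p ∧
    |sch.c r.curvature k| * |sch.m r.curvature k| ≤ (sch.a k)⁻¹ ^ p

/-- Scheme clause (ii): the physical torus side beats the logarithm of the cutoff, `a_k L_k / log a_k⁻¹ → ∞`. -/
def SideGrowth : Prop :=
  Tendsto (fun k => sch.a k * (sch.L k : ℝ) / Real.log (sch.a k)⁻¹) atTop atTop

/-- **`Growth`**: the scheme growth clause of the line (∃-form data on the witness scheme). -/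
def Growth : Prop := TemperateRenormalisation r sch ∧ SideGrowth sch

/-- The door-B letters as one `Prop` over `(r, sch)`: SOME model satisfies R1 and R2. -/
def TwistLetters : Prop := ∃ 𝔪 : DiagonalSliceModel r sch, OddTwistGap 𝔪 ∧ DiagLukewarm 𝔪

/-! ### §3b Adapters to the door-B clauses already in the tree (`…Cruxes.HypercubicLimit.CouplingResponse.PolyRenorm`,
`.PolyVolume`, Theorems/MirrorModularBoostsHypercubicLimitCouplingResponseDefsC.lean :116 / :123 — cited, not restated).
`PolyVolume sch` (`a_k⁻¹ ≤ (a_k L_k)^N` eventually) is STRONGER than `SideGrowth`; `PolyRenorm r sch` is the `c`-half of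
`TemperateRenormalisation`; the `m`-half (`PolyCounterterm`) is automatic when `m_k` is the torus mean of the bounded density. -/

/-- Polynomial growth of the RENORMALISED counterterm `c_k · m_k` of the curvature species (the `m`-half of
`TemperateRenormalisation`; κ3).  Implied by `PolyRenorm` together with a uniform bound on the one-point family
observable (`UniformFunctionalBoundPlanes`, n = 1, a bump function) — that adapter belongs under `Theorems/` where the
functional bound is declared. -/
def PolyRenormCounterterm : Prop :=
  ∃ p : ℕ, ∀ᶠ k in atTop, |sch.c r.curvature k| * |sch.m r.curvature k| ≤ (sch.a k)⁻¹ ^ p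

/-- Polynomial growth of the BARE additive counterterm (the pre-κ3 `m`-half; kept because it is the natural clause when
`m_k` is the torus mean of the bounded density, and it implies `PolyRenormCounterterm` under `PolyRenorm`). -/
def PolyCounterterm : Prop := ∃ p : ℕ, ∀ᶠ k in atTop, |sch.m r.curvature k| ≤ (sch.a k)⁻¹ ^ p

/-- Adapter: `PolyRenorm` and the bare `PolyCounterterm` give `PolyRenormCounterterm` (exponents add). -/
theorem polyRenormCounterterm_of_polyCounterterm
    (hc : Summit.QuantumFields.YangMills.Cruxes.HypercubicLimit.CouplingResponse.PolyRenorm r sch)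
    (hm : PolyCounterterm r sch) : PolyRenormCounterterm r sch := by
  obtain ⟨Q, hQ⟩ := hc
  obtain ⟨p, hp⟩ := hm
  refine ⟨Q + p, ?_⟩
  filter_upwards [hp] with k hk
  rw [pow_add]
  exact mul_le_mul (hQ k) hk (abs_nonneg _) (pow_nonneg (inv_pos.2 (sch.a_pos k)).le _)

/-- Adapter: `PolyRenorm` (the `c`-half, tree clause) and `PolyRenormCounterterm` (the renormalised `m`-half) give
`TemperateRenormalisation` (raise both exponents to their max; `a_k ≤ 1` eventually). -/
theorem temperateRenormalisation_of_polyRenorm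
    (hc : Summit.QuantumFields.YangMills.Cruxes.HypercubicLimit.CouplingResponse.PolyRenorm r sch)
    (hm : PolyRenormCounterterm r sch) : TemperateRenormalisation r sch := by
  obtain ⟨Q, hQ⟩ := hc
  obtain ⟨p, hp⟩ := hm
  refine ⟨max Q p, ?_⟩
  have ha1 : ∀ᶠ k in atTop, sch.a k ≤ 1 := sch.tendsto_a.eventually (eventually_le_nhds one_pos)
  filter_upwards [hp, ha1] with k hk hk1
  have hinv : 1 ≤ (sch.a k)⁻¹ := one_le_inv_iff₀.2 ⟨sch.a_pos k, hk1⟩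
  exact ⟨(hQ k).trans (pow_le_pow_right₀ hinv (le_max_left _ _)),
    hk.trans (pow_le_pow_right₀ hinv (le_max_right _ _))⟩

/-- `x / (N log x) → ∞`. -/
theorem tendsto_div_mul_log_atTop (N : ℝ) (hN : 0 < N) :
    Tendsto (fun x : ℝ => x / (N * Real.log x)) atTop atTop := by
  have h1 : Tendsto (fun x : ℝ => Real.log x / x) atTop (𝓝 0) := by
    have := Real.tendsto_pow_log_div_mul_add_atTop 1 0 1 one_ne_zero
    simpa using this
  have h0 : Tendsto (fun x : ℝ => N * Real.log x / x) atTop (𝓝 0) := by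
    simpa [mul_div_assoc] using h1.const_mul N
  have hpos : ∀ᶠ x : ℝ in atTop, N * Real.log x / x ∈ Set.Ioi (0 : ℝ) := by
    filter_upwards [eventually_gt_atTop 1] with x hx
    have : 0 < Real.log x := Real.log_pos hx
    exact div_pos (mul_pos hN this) (by linarith)
  have h0' : Tendsto (fun x : ℝ => N * Real.log x / x) atTop (𝓝[>] 0) :=
    tendsto_nhdsWithin_iff.2 ⟨h0, hpos⟩
  have := h0'.inv_tendsto_nhdsGT_zero
  refine this.congr' ?_
  filter_upwards with x
  simp [inv_div]

/-- Adapter: `PolyVolume sch` (`a_k⁻¹ ≤ (a_k L_k)^N` eventually) implies `SideGrowth`: `log a_k⁻¹ ≤ N log (a_k L_k)` and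
`x / (N log x) → ∞` along `x = a_k L_k → ∞`. -/
theorem sideGrowth_of_polyVolume {ι : Type} (sch : SpeciesScheme ι)
    (hV : Summit.QuantumFields.YangMills.Cruxes.HypercubicLimit.CouplingResponse.PolyVolume sch) :
    Tendsto (fun k => sch.a k * (sch.L k : ℝ) / Real.log (sch.a k)⁻¹) atTop atTop := by
  obtain ⟨N, hN1, hev⟩ := hV
  have hx : Tendsto (fun k => sch.a k * (sch.L k : ℝ)) atTop atTop := sch.tendsto_L
  have hNpos : (0 : ℝ) < N := by exact_mod_cast hN1
  have hcomp := (tendsto_div_mul_log_atTop (N : ℝ) hNpos).comp hx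
  refine tendsto_atTop_mono' atTop ?_ hcomp
  have ha1 : ∀ᶠ k in atTop, sch.a k < 1 := sch.tendsto_a.eventually (eventually_lt_nhds one_pos)
  filter_upwards [hev, ha1, hx.eventually_gt_atTop 1] with k hk hk1 hx1
  have ha := sch.a_pos k
  have hlogpos : 0 < Real.log (sch.a k)⁻¹ := Real.log_pos ((one_lt_inv₀ ha).2 hk1)
  have hle : Real.log (sch.a k)⁻¹ ≤ (N : ℝ) * Real.log (sch.a k * (sch.L k : ℝ)) := by
    rw [← Real.log_pow]
    exact Real.log_le_log (inv_pos.2 ha) hk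
  simp only [Function.comp]
  exact div_le_div_of_nonneg_left (by linarith) hlogpos hle

/-- **growth_of_poly** (pre-κ3 adapter, kept): `PolyRenorm → PolyCounterterm → PolyVolume → Growth`. -/
theorem growth_of_poly
    (hc : Summit.QuantumFields.YangMills.Cruxes.HypercubicLimit.CouplingResponse.PolyRenorm r sch)
    (hm : PolyCounterterm r sch)
    (hV : Summit.QuantumFields.YangMills.Cruxes.HypercubicLimit.CouplingResponse.PolyVolume sch) : Growth r sch :=
  ⟨temperateRenormalisation_of_polyRenorm r sch hc (polyRenormCounterterm_of_polyCounterterm r sch hc hm),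
    sideGrowth_of_polyVolume sch hV⟩

/-- κ3 form of the adapter: `Growth` from `PolyRenorm`, the RENORMALISED counterterm bound and `PolyVolume`. -/
theorem growth_of_polyRenormCounterterm
    (hc : Summit.QuantumFields.YangMills.Cruxes.HypercubicLimit.CouplingResponse.PolyRenorm r sch)
    (hm : PolyRenormCounterterm r sch)
    (hV : Summit.QuantumFields.YangMills.Cruxes.HypercubicLimit.CouplingResponse.PolyVolume sch) : Growth r sch :=
  ⟨temperateRenormalisation_of_polyRenorm r sch hc hm, sideGrowth_of_polyVolume sch hV⟩


end Letters

/-! ### §3c (new, λ1) The letters BY NAME along a strictly increasing `φ` -/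

section AlongSubseq

variable {G : Type} [Group G] [TopologicalSpace G] [IsTopologicalGroup G] [CompactSpace G]
  [MeasurableSpace G] [BorelSpace G] {r : LatticeRep G} {sch : SpeciesScheme (YMSpecies G)}

/-- **R1 along `φ`**: `OddTwistGap 𝔪 → OddTwistGap (𝔪.restrict φ hφ)` (same rate `γ`). -/
theorem OddTwistGap.restrict {𝔪 : DiagonalSliceModel r sch} (h : OddTwistGap 𝔪) (φ : ℕ → ℕ) (hφ : StrictMono φ) :
    OddTwistGap (𝔪.restrict φ hφ) := by
  obtain ⟨γ, hγ, hev⟩ := h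
  exact ⟨γ, hγ, 𝔪.restrict_oddTwistGap φ hφ hev⟩

/-- **R2 along `φ`**: `DiagLukewarm 𝔪 → DiagLukewarm (𝔪.restrict φ hφ)` (same `θ`, `C`). -/
theorem DiagLukewarm.restrict {𝔪 : DiagonalSliceModel r sch} (h : DiagLukewarm 𝔪) (φ : ℕ → ℕ) (hφ : StrictMono φ) :
    DiagLukewarm (𝔪.restrict φ hφ) := by
  obtain ⟨θ, hθ0, hθ, C, hev⟩ := h
  exact ⟨θ, hθ0, hθ, C, 𝔪.restrict_diagLukewarm φ hφ hev⟩

variable (r sch)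

/-- **`TwistLetters` along `φ`**: letters on SOME model on the scheme give letters on SOME model on every sub-scheme (its restriction). -/
theorem TwistLetters.subseq (h : TwistLetters r sch) (φ : ℕ → ℕ) (hφ : StrictMono φ) : TwistLetters r (subseq sch φ hφ) := by
  obtain ⟨𝔪, hR1, hR2⟩ := h
  exact ⟨𝔪.restrict φ hφ, hR1.restrict φ hφ, hR2.restrict φ hφ⟩

/-- `TemperateRenormalisation` (κ3 text) restricts to sub-schemes (same exponent). -/
theorem TemperateRenormalisation.subseq (h : TemperateRenormalisation r sch) (φ : ℕ → ℕ) (hφ : StrictMono φ) :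
    TemperateRenormalisation r (subseq sch φ hφ) := by
  obtain ⟨p, hp⟩ := h
  exact ⟨p, hφ.tendsto_atTop.eventually hp⟩

/-- `PolyRenormCounterterm` restricts to sub-schemes. -/
theorem PolyRenormCounterterm.subseq (h : PolyRenormCounterterm r sch) (φ : ℕ → ℕ) (hφ : StrictMono φ) :
    PolyRenormCounterterm r (subseq sch φ hφ) := by
  obtain ⟨p, hp⟩ := h
  exact ⟨p, hφ.tendsto_atTop.eventually hp⟩

/-- `PolyCounterterm` restricts to sub-schemes. -/
theorem PolyCounterterm.subseq (h : PolyCounterterm r sch) (φ : ℕ → ℕ) (hφ : StrictMono φ) :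
    PolyCounterterm r (subseq sch φ hφ) := by
  obtain ⟨p, hp⟩ := h
  exact ⟨p, polyCounterterm_subseq r sch φ hφ hp⟩

omit [TopologicalSpace G] [IsTopologicalGroup G] [CompactSpace G] [BorelSpace G] in
/-- `SideGrowth` restricts to sub-schemes (a `Tendsto … atTop atTop` composed with `φ → ∞`). -/
theorem SideGrowth.subseq (h : SideGrowth sch) (φ : ℕ → ℕ) (hφ : StrictMono φ) : SideGrowth (subseq sch φ hφ) :=
  sideGrowth_subseq sch φ hφ h

/-- **`Growth` restricts to sub-schemes.** -/
theorem Growth.subseq (h : Growth r sch) (φ : ℕ → ℕ) (hφ : StrictMono φ) : Growth r (subseq sch φ hφ) :=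
  ⟨h.1.subseq r sch φ hφ, h.2.subseq sch φ hφ⟩

/-- **`PolyRenormCounterterm` from D1's own binders** (the landed κ3 adapter `polyRenormCounterterm_of_ufbPlanes`, p827519, BY NAME). -/
theorem polyRenormCounterterm_of_polyRenorm_of_ufbPlanes
    (hc : Summit.QuantumFields.YangMills.Cruxes.HypercubicLimit.CouplingResponse.PolyRenorm r sch)
    (hU : UniformFunctionalBoundPlanes r sch) : PolyRenormCounterterm r sch :=
  polyRenormCounterterm_of_ufbPlanes r sch hc hU

/-- **`Growth` from D1's own binders**: `PolyRenorm ∧ UniformFunctionalBoundPlanes ∧ PolyVolume ⇒ Growth r sch` (κ3: the scheme letter of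
door B is no longer a letter). -/
theorem growth_of_polyRenorm_of_ufbPlanes
    (hc : Summit.QuantumFields.YangMills.Cruxes.HypercubicLimit.CouplingResponse.PolyRenorm r sch)
    (hU : UniformFunctionalBoundPlanes r sch)
    (hV : Summit.QuantumFields.YangMills.Cruxes.HypercubicLimit.CouplingResponse.PolyVolume sch) : Growth r sch :=
  growth_of_polyRenormCounterterm r sch hc (polyRenormCounterterm_of_ufbPlanes r sch hc hU) hV

/-- **`Growth` on every sub-scheme from D1's own binders on the SCHEME** — the scheme letter at the sub-scheme `subseq sch φ hφ` where the
transfer `diagRPOfPlaneLimits_of_swapPairingLiminf` (p827255) consumes the socket. -/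
theorem growth_subseq_of_polyRenorm_of_ufbPlanes
    (hc : Summit.QuantumFields.YangMills.Cruxes.HypercubicLimit.CouplingResponse.PolyRenorm r sch)
    (hU : UniformFunctionalBoundPlanes r sch)
    (hV : Summit.QuantumFields.YangMills.Cruxes.HypercubicLimit.CouplingResponse.PolyVolume sch) (φ : ℕ → ℕ) (hφ : StrictMono φ) :
    Growth r (subseq sch φ hφ) :=
  (growth_of_polyRenorm_of_ufbPlanes r sch hc hU hV).subseq r sch φ hφ

end AlongSubseq

end Summit.QuantumFields.YangMills.Cruxes.DiagonalMirrorRPR.SignTwistedDiagonalTrace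

end
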